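import Summits.CriticalPhenomena.CardyFormulaZ2.Theorems.CardyMagicRigidityNestingRigidityNeckCoarseZ2Reduction
import HarnessLib

/-!
# Crux `NestingRigidity`, line `pinch-resampling` (v4), stub S12: the canonical surrogate `ZHookStar` and the reduction of `NeckHookupCoarseZ2` to ONE estimate

Crux `Summit.CriticalPhenomena.CardyFormulaZ2.Theses.CardyMagicRigidity.NestingRigidity`
(stmt-CriticalPhenomena-4835), line `pinch-resampling` v4, vocabulary `…PinchResamplingDefsV4` (p152476), stub S12
`stub_neckHookupCoarseZ2 : NeckHookupCoarseZ2`.  Sequel of the landed `…NeckCoarseZ2Reduction` (p154210,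
`neckHookupCoarseZ2_of_surrogate`: S12 follows from a measurable SURROGATE event reading only the pairs meeting the
box and the coarse datum, with `P(Sel ∩ (ZHookR Δ E)) ≤ b · P(Sel)` in the window).  Here the surrogate is PINNED
to the typing note's "hook-up through `ℓ`-fuzzy attachments to the big blobs" (`S10-typing.md` §2), the `ℤ²` twin
of `THookStar` (`…NestingRigidityNeckHookStar`, stub S11):

* §1 `zIntGraph x s ω` (open LATTICE edges meeting the box), `ZFuzzyLink` (two footprints have inner-layer vertices
  in cells of theirs joined through the box; `a = b` allowed), `ZHookStar ℓ lam s x o` (all big CROSSING footprints of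
  `zCoarse` are chained by fuzzy links through big footprints), and the remaining estimate `ZHookStarBound : Prop`
  (NOT asserted; it is the hypothesis of the final theorem).
* §2 `ZHookStar` reads only the pairs meeting the box and the coarse datum (`zHookStar_dep`, the hypothesis `hdep` of
  `neckHookupCoarseZ2_of_surrogate`), is determined by the pairs of `Λ_{2s+1}(x)` and is measurable.
* §3 `neckHookupCoarseZ2_of_hookStarBound : ZHookStarBound → NeckHookupCoarseZ2` (registered anchor).

What `ZHookStarBound` costs (worker analysis, S12 wave 3–4, and the S11 road map in `…NeckHookStar`): on the selection
event the error `ZHookR Δ ZHookStar` splits into 𝔄 (fuzzy chain but honest disconnection) and 𝔅 (honest connection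
using SMALL inner-touching blobs essentially); both are covered by CLUSTER-FORM four-arm events around inner-layer
cells (`fourArmTwoClustersAt`, whose two-radius bound with exponent `> 1` is the tree theorem
`QuadCrossing.fourArm_bound` + `real_fourArmTwoClustersAt`), but with an UNBOUNDED number of fuzzy junctions, so the
summation is a multi-scale (single-linkage hierarchy) bookkeeping, not a plain union bound over cells — a plain union
bound `(s/ℓ) · π₄(ℓ, lam)` does not tend to `0` in the window.  Further inputs: RSW positivity of `ZFourStrands x s`
at ratio `2`, and for 𝔅 a "touching necklace" bound.  The window constraint `s³ ℓ ≤ lam⁴` is not used by this route.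
-/

noncomputable section

namespace Summit.CriticalPhenomena.CardyFormulaZ2.Cruxes.NestingRigidity.PinchResampling

open MeasureTheory Set Literature.Probability.Percolation Literature.Probability.LatticeModels
open ZPinchLocality NeckCoarseZ2

/-! ## §1 The surrogate: fuzzy hook-up through the big blobs -/

/-- **The interior open LATTICE graph of the box `Λ_s(x)`**: open lattice edges of `ω` with an endpoint in the box
(the resampled pairs; junk pairs discarded). -/
def zIntGraph (x : Site 2) (s : ℕ) (ω : BondConfig (Site 2)) : SimpleGraph (Site 2) where
  Adj a b := (zdGraph 2).Adj a b ∧ s(a, b) ∈ ω ∧ (a ∈ zBall x s ∨ b ∈ zBall x s)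
  symm := ⟨fun _ _ h ↦ ⟨h.1.symm, by rw [Sym2.eq_swap]; exact h.2.1, h.2.2.symm⟩⟩
  loopless := ⟨fun _ h ↦ h.1.ne rfl⟩

/-- A pair with an endpoint in the box is a resampled pair. -/
theorem mk_mem_compl_zExtEdges_left {x : Site 2} {s : ℕ} {a : Site 2} (ha : a ∈ zBall x s) (b : Site 2) :
    s(a, b) ∈ (zExtEdges x s)ᶜ :=
  fun h ↦ h a (Sym2.mem_mk_left _ _) ha

/-- **Fuzzy link of two footprints through the box**: inner-layer vertices `a`, `b` whose `ℓ`-cells lie in the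
footprints `S`, `T`, joined by an interior open lattice path through the box (`a = b` allowed: footprints sharing a
cell are linked). -/
def ZFuzzyLink (ℓ s : ℕ) (x o : Site 2) (ω : BondConfig (Site 2)) (S T : Set (Site 2)) : Prop :=
  ∃ a ∈ innerLayer (zdGraph 2) (zBall x s) (zBall x (2 * s)), ∃ b ∈ innerLayer (zdGraph 2) (zBall x s) (zBall x (2 * s)),
    cellOf ℓ o a ∈ S ∧ cellOf ℓ o b ∈ T ∧
      PathIn (zIntGraph x s ω) (zBall x s ∪ innerLayer (zdGraph 2) (zBall x s) (zBall x (2 * s))) a b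

/-- **The surrogate hook-up `Hook*`** of the typing note (§2): all big CROSSING footprints of the coarse datum
`σ = zCoarse ℓ lam s x o ω` are joined by chains of fuzzy links through footprints of `σ` (crossing or dangling).
By construction a function of (the pairs meeting the box, `σ`). -/
def ZHookStar (ℓ lam s : ℕ) (x o : Site 2) : Set (BondConfig (Site 2)) :=
  {ω | ∀ S ∈ (zCoarse ℓ lam s x o ω).1, ∀ T ∈ (zCoarse ℓ lam s x o ω).1,
    Relation.EqvGen (fun A B ↦ A ∈ (zCoarse ℓ lam s x o ω).1 ∪ (zCoarse ℓ lam s x o ω).2 ∧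
      B ∈ (zCoarse ℓ lam s x o ω).1 ∪ (zCoarse ℓ lam s x o ω).2 ∧ ZFuzzyLink ℓ s x o ω A B) S T}

/-- **The remaining input of S12, as ONE estimate** (a statement, NOT asserted here — it is the hypothesis of
`neckHookupCoarseZ2_of_hookStarBound`): in the window, the surrogate differs from the primal hook-up on a part of the
selection event of relative probability `≤ b`. -/
def ZHookStarBound : Prop :=
  ∀ b : ℝ, 0 < b → ∃ L : ℕ, ∀ (x o : Site 2) (ℓ lam s : ℕ), 1 ≤ ℓ → s ^ 3 * ℓ ≤ lam ^ 4 → L * lam ≤ s →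
    (bondPercolation (zdGraph 2) half).real (ZFourStrands x s ∩ symmDiff (ZHookR x s) (ZHookStar ℓ lam s x o)) ≤
      b * (bondPercolation (zdGraph 2) half).real (ZFourStrands x s)

/-! ## §2 The surrogate reads only the pairs meeting the box and the coarse datum; measurability -/

/-- Boxes are monotone in the radius. -/
theorem zBall_mono (x : Site 2) {m n : ℕ} (h : m ≤ n) : zBall x m ⊆ zBall x n := by
  intro v hv
  rw [mem_zBall_iff] at hv ⊢
  simp only [abs_le] at hv ⊢
  omega

/-- The pairs read by the interior lattice graph lie inside `Λ_{s+1}(x)`. -/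
theorem mem_zBall_succ_of_adj_of_or {x : Site 2} {s : ℕ} {a b : Site 2} (hab : (zdGraph 2).Adj a b)
    (h : a ∈ zBall x s ∨ b ∈ zBall x s) : a ∈ zBall x (s + 1) ∧ b ∈ zBall x (s + 1) := by
  rcases h with ha | hb
  · exact ⟨zBall_subset_zBall_succ x s ha, mem_zBall_succ_of_adj ha hab⟩
  · exact ⟨mem_zBall_succ_of_adj hb hab.symm, zBall_subset_zBall_succ x s hb⟩

/-- The interior lattice graph only reads the configuration on lattice pairs meeting the box. -/
theorem zIntGraph_eq_of_agree {x : Site 2} {s : ℕ} {ω ω' : BondConfig (Site 2)}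
    (h : ∀ a b : Site 2, (zdGraph 2).Adj a b → (a ∈ zBall x s ∨ b ∈ zBall x s) → (s(a, b) ∈ ω ↔ s(a, b) ∈ ω')) :
    zIntGraph x s ω = zIntGraph x s ω' := by
  ext a b
  simp only [zIntGraph]
  constructor
  · rintro ⟨h1, h2, h3⟩
    exact ⟨h1, (h a b h1 h3).1 h2, h3⟩
  · rintro ⟨h1, h2, h3⟩
    exact ⟨h1, (h a b h1 h3).2 h2, h3⟩

/-- The interior lattice graph reads only the pairs meeting the box. -/
theorem zIntGraph_eq_of_inter_eq {x : Site 2} {s : ℕ} {ω ω' : BondConfig (Site 2)}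
    (h : ω ∩ (zExtEdges x s)ᶜ = ω' ∩ (zExtEdges x s)ᶜ) : zIntGraph x s ω = zIntGraph x s ω' := by
  refine zIntGraph_eq_of_agree fun a b _ hab ↦ ?_
  have hK : s(a, b) ∈ (zExtEdges x s)ᶜ := by
    rcases hab with ha | hb
    · exact mk_mem_compl_zExtEdges_left ha b
    · rw [Sym2.eq_swap]
      exact mk_mem_compl_zExtEdges_left hb a
  exact ⟨fun h1 ↦ ((Set.ext_iff.1 h _).1 ⟨h1, hK⟩).1, fun h1 ↦ ((Set.ext_iff.1 h _).2 ⟨h1, hK⟩).1⟩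

/-- **`ZHookStar` reads only the pairs meeting the box and the coarse datum** (hypothesis `hdep` of
`NeckCoarseZ2.exists_G_of_surrogate` / `neckHookupCoarseZ2_of_surrogate`). -/
theorem zHookStar_dep (ℓ lam s : ℕ) (x o : Site 2) : ∀ ω ω' : BondConfig (Site 2), ω ∩ (zExtEdges x s)ᶜ = ω' ∩ (zExtEdges x s)ᶜ → zCoarse ℓ lam s x o ω = zCoarse ℓ lam s x o ω' → ω ∈ ZHookStar ℓ lam s x o → ω' ∈ ZHookStar ℓ lam s x o := by
  intro ω ω' hK hσ hω
  simp only [ZHookStar, mem_setOf_eq, ZFuzzyLink] at hω ⊢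
  rw [← hσ, ← zIntGraph_eq_of_inter_eq hK]
  exact hω

/-- `ZHookStar` is determined by the pairs inside `Λ_{2s+1}(x)`. -/
theorem zHookStar_determinedBy (ℓ lam s : ℕ) (x o : Site 2) :
    DeterminedBy (ZHookStar ℓ lam s x o) (zBall x (2 * s + 1)).sym2 := by
  rw [determinedBy_iff]
  intro ω ω' h
  have hmem : ∀ e ∈ (zBall x (2 * s + 1)).sym2, e ∈ ω ↔ e ∈ ω' := fun e he ↦
    ⟨fun h1 ↦ ((Set.ext_iff.1 h e).1 ⟨h1, he⟩).1, fun h1 ↦ ((Set.ext_iff.1 h e).2 ⟨h1, he⟩).1⟩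
  have hσ : zCoarse ℓ lam s x o ω = zCoarse ℓ lam s x o ω' := by
    refine zCoarse_congr (Set.ext fun e ↦ ?_)
    simp only [mem_inter_iff]
    refine ⟨fun ⟨he, hC⟩ ↦ ⟨(hmem e ?_).1 he, hC⟩, fun ⟨he, hC⟩ ↦ ⟨(hmem e ?_).2 he, hC⟩⟩ <;>
      exact Set.mem_sym2_iff_subset.2 fun v hv ↦
        zBall_mono x (by omega) ((Set.mem_sym2_iff_subset.1 hC) hv).1
  have hG : zIntGraph x s ω = zIntGraph x s ω' := by
    refine zIntGraph_eq_of_agree fun a b hab h3 ↦ hmem _ ?_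
    obtain ⟨ha, hb⟩ := mem_zBall_succ_of_adj_of_or hab h3
    rw [Set.mk_mem_sym2_iff]
    exact ⟨zBall_mono x (by omega) ha, zBall_mono x (by omega) hb⟩
  simp only [ZHookStar, mem_setOf_eq, ZFuzzyLink, hσ, hG]

/-- `ZHookStar` is measurable (a cylinder event on finitely many pairs). -/
theorem measurableSet_zHookStar (ℓ lam s : ℕ) (x o : Site 2) : MeasurableSet (ZHookStar ℓ lam s x o) := by
  have h := zHookStar_determinedBy ℓ lam s x o
  rw [← (finite_sym2 (zBall_finite x (2 * s + 1))).coe_toFinset] at h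
  exact h.measurableSet_of_finset

/-! ## §3 S12 from the single estimate -/

/-- **S12 reduces to `ZHookStarBound`** (`neckHookupCoarseZ2_of_surrogate` with `E := ZHookStar ℓ lam s x o`). -/
theorem neckHookupCoarseZ2_of_hookStarBound : ZHookStarBound → NeckHookupCoarseZ2 := fun h ↦
  neckHookupCoarseZ2_of_surrogate fun b hb ↦ by
    obtain ⟨L, hL⟩ := h b hb
    exact ⟨L, fun x o ℓ lam s hℓ hw hLs ↦ ⟨ZHookStar ℓ lam s x o, measurableSet_zHookStar ℓ lam s x o,
      zHookStar_dep ℓ lam s x o, hL x o ℓ lam s hℓ hw hLs⟩⟩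

end Summit.CriticalPhenomena.CardyFormulaZ2.Cruxes.NestingRigidity.PinchResampling

end
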